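import Summits.AnomalousDissipation.AnomalousDissipation.Theses.DopplerClock
import Summits.AnomalousDissipation.AnomalousDissipation.Theorems.ImpulseGridAssembly
import Summits.AnomalousDissipation.AnomalousDissipation.Theorems.ImpulseGridGridSignsLawInjectionNonneg
import Summits.AnomalousDissipation.AnomalousDissipation.Theorems.ImpulseGridGridSignsLawStubLoudWakes
import Literature.Analysis.FluidPDE.DoeringFoiasPowerProofs

/-!
# Route DopplerClock — the glue `CruxesGiveTarget` (item stmt-AnomalousDissipation-18135)

`QuadratureStressFloor → InjectionControlsEnergy → DopplerWorkIdentity → DopplerZerothLaw`.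

Take `F, V, m, n, Λ` and the family `(ν, u₀, u)` from C1 (`QuadratureStressFloor`), with its
per-`j` sup-in-time energy bounds, the no-leakage clause and the stress floor
`ε₀ ≤ -Λ⟨T_s(w_j)⟩`.

* **Uniform energy.** C2 (`InjectionControlsEnergy`) gives `E_j ≤ C (1 + W_j)` with
  `E_j = meanEnergy (u j)` and `W_j` the `limsup`-mean injection. The mean injection is
  non-negative (`0 ≤ Λ⟨(f,u_j)⟩ ≤ W_j`, energy inequality from `0`,
  `impulseGrid_longTimeAvg_injection_nonneg` and `Λ ≤ limsup`), so `C` may be replaced by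
  `C⁺ = max C 0`, and `W_j ≤ ‖f‖₂ √E_j` (Cauchy–Schwarz in space, Jensen in time —
  `Torus.IsGlobalLerayHopf.abs_timeMean_power_le` — and `limsup` commutes with the monotone
  continuous `y ↦ ‖f‖₂ √y` on the bounded Cesàro means of the energy). The quadratic inequality
  `E ≤ C⁺ (1 + ‖f‖₂ √E)` gives `E_j ≤ 2 C⁺ + (C⁺ ‖f‖₂)²` uniformly in `j`.
* **Floor.** `|Λ⟨(Ψ_s, u_j)⟩| ≤ M` uniformly (`impulseGrid_longTimeAvg_inner_le` on `±Ψ_s`), so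
  the identity `Λ⟨(f,u_j)⟩ = (F/(V·2πn)) (ν_j κ² Λ⟨(Ψ_s,u_j)⟩ − Λ⟨T_s⟩)` and the floor give
  `Λ⟨(f,u_j)⟩ ≥ (F/(V·2πn)) · ε₀/2` once `ν_j (κ² M + 1) < ε₀/2`, i.e. for `j ≥ J` (`ν → 0`);
  then `Λ ≤ limsup ≤ meanDissipation` (no leakage), and the target holds along `j ↦ j + J`
  (Doering–Foias 2002, §2; Foias–Manley–Rosa–Temam 2001, Ch. IV §1 for the generalized limits).

No new definitions.
-/

noncomputable section

open MeasureTheory Set Filter Topology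
open scoped InnerProductSpace RealInnerProductSpace

-- `Summit.<Summit>.<Problem>` is the tree's mandated summit-side namespace (CONVENTIONS §2); for this
-- single-conjunct summit the two coincide, so the duplicate is deliberate.
set_option linter.dupNamespace false

namespace Summit.AnomalousDissipation.AnomalousDissipation.Theorems

open Literature.Analysis.FunctionSpaces Literature.Analysis.FunctionSpaces.Torus
open Literature.Analysis.FluidPDE Literature.Analysis.FluidPDE.Torus

variable {ν : ℝ} {f a u₀ : UnitAddTorus (Fin 3) → EuclideanSpace ℝ (Fin 3)}
  {u : ℝ → UnitAddTorus (Fin 3) → EuclideanSpace ℝ (Fin 3)}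

/-- The Doppler pair of Stokes modes `x ↦ (c · Im e_k(x) · Re e_l(x)) e` is smooth (product of
components of the smooth characters `UnitAddTorus.mFourier`, times a constant vector). [folklore] -/
theorem dopplerClock_isSmooth_im_mul_re_smul (c : ℝ) (k l : Fin 3 → ℤ)
    (e : EuclideanSpace ℝ (Fin 3)) :
    IsSmooth (fun x : UnitAddTorus (Fin 3) =>
      (c * (UnitAddTorus.mFourier k x).im * (UnitAddTorus.mFourier l x).re) • e) := by
  have h1 : IsSmooth (fun x : UnitAddTorus (Fin 3) => (UnitAddTorus.mFourier k x).im) :=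
    (isSmooth_mFourier k).comp_clm Complex.imCLM
  have h2 : IsSmooth (fun x : UnitAddTorus (Fin 3) => (UnitAddTorus.mFourier l x).re) :=
    (isSmooth_mFourier l).comp_clm Complex.reCLM
  have h3 : IsSmooth (fun x : UnitAddTorus (Fin 3) =>
      c * (UnitAddTorus.mFourier k x).im * (UnitAddTorus.mFourier l x).re) := by
    unfold IsSmooth at h1 h2 ⊢
    exact (contDiff_const.mul h1).mul h2
  exact h3.smul' (isSmooth_const e)

/-- The quadrature streak pattern `x ↦ (Im e_k(x) · Im e_l(x)) e` is smooth. [folklore] -/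
theorem dopplerClock_isSmooth_im_mul_im_smul (k l : Fin 3 → ℤ) (e : EuclideanSpace ℝ (Fin 3)) :
    IsSmooth (fun x : UnitAddTorus (Fin 3) =>
      ((UnitAddTorus.mFourier k x).im * (UnitAddTorus.mFourier l x).im) • e) := by
  have h1 : IsSmooth (fun x : UnitAddTorus (Fin 3) => (UnitAddTorus.mFourier k x).im) :=
    (isSmooth_mFourier k).comp_clm Complex.imCLM
  have h2 : IsSmooth (fun x : UnitAddTorus (Fin 3) => (UnitAddTorus.mFourier l x).im) :=
    (isSmooth_mFourier l).comp_clm Complex.imCLM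
  have h3 : IsSmooth (fun x : UnitAddTorus (Fin 3) =>
      (UnitAddTorus.mFourier k x).im * (UnitAddTorus.mFourier l x).im) := by
    unfold IsSmooth at h1 h2 ⊢
    exact h1.mul h2
  exact h3.smul' (isSmooth_const e)

/-- **`limsup`-mean injection against mean energy under a sup-energy bound.** Along a global
Leray–Hopf solution driven by the steady smooth force `f`, with `½‖u(t)‖₂² ≤ C` for `t ≥ 0`,
`limsup_T T⁻¹∫₀ᵀ (f, u(t)) dt ≤ ‖f‖₂ √(meanEnergy u)`: pointwise in `T`,
`|T⁻¹∫₀ᵀ(f,u)| ≤ ‖f‖₂ (T⁻¹∫₀ᵀ‖u‖₂²)^{1/2}` (Cauchy–Schwarz in space, Jensen in time,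
`Torus.IsGlobalLerayHopf.abs_timeMean_power_le`), the Cesàro means of the energy lie in `[0, 2C]`
for `T > 0`, and `limsup` commutes with the monotone continuous `y ↦ ‖f‖₂ √y` there. The twin
`Torus.IsGlobalLerayHopf.meanPower_le` assumes a mean-zero force instead of the sup-energy bound
(Cheskidov–Doering–Petrov 2007, eq. (17); Doering–Foias 2002, §2). [folklore] -/
theorem dopplerClock_longTimeAvgSup_inner_le_sqrt (hf : IsSmooth f)
    (hu : IsGlobalLerayHopf ν (fun _ => f) u₀ u) {C : ℝ}
    (hC : ∀ t : ℝ, 0 ≤ t → kineticEnergy (u t) ≤ C) :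
    longTimeAvgSup (fun t => ∫ x, ⟪f x, u t x⟫) ≤
      Real.sqrt (∫ x, ‖f x‖ ^ 2) * Real.sqrt (meanEnergy u) := by
  rw [meanEnergy_eq_longTimeAvgSup]
  unfold longTimeAvgSup
  set E : ℝ → ℝ := fun τ => ∫ x, ‖u τ x‖ ^ 2 with hEdef
  set P : ℝ → ℝ := fun τ => ∫ x, ⟪f x, u τ x⟫ with hPdef
  set A : ℝ := Real.sqrt (∫ x, ‖f x‖ ^ 2) with hA
  set g : ℝ → ℝ := fun y => A * Real.sqrt y with hg
  have hA0 : 0 ≤ A := Real.sqrt_nonneg _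
  have hE0 : ∀ τ, 0 ≤ E τ := fun τ => integral_nonneg fun _ => sq_nonneg _
  have hg_mono : Monotone g := fun x y hxy =>
    mul_le_mul_of_nonneg_left (Real.sqrt_le_sqrt hxy) hA0
  have hg_cont : Continuous g := continuous_const.mul Real.continuous_sqrt
  -- pointwise bounds and boundedness of the Cesàro means of the energy
  have hpt : ∀ T, 0 < T → |timeMean P T| ≤ g (timeMean E T) := fun T hT =>
    hu.abs_timeMean_power_le hf hT
  have hBK : ∀ᶠ T in atTop, timeMean E T ≤ 2 * C :=
    (eventually_gt_atTop 0).mono fun T hT => impulseGrid_timeMean_energy_le hC hT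
  have hB0 : ∀ᶠ T in atTop, 0 ≤ timeMean E T :=
    (eventually_ge_atTop 0).mono fun T hT => timeMean_nonneg hE0 hT
  have hBbdd : IsBoundedUnder (· ≤ ·) atTop (timeMean E) := isBoundedUnder_of_eventually_le hBK
  have hBcobdd : IsCoboundedUnder (· ≤ ·) atTop (timeMean E) :=
    isCoboundedUnder_le_of_eventually_le atTop hB0
  -- comparison of the `limsup`s
  have h1 : limsup (timeMean P) atTop ≤ limsup (g ∘ timeMean E) atTop := by
    refine limsup_le_limsup ?_ ?_ ?_
    · filter_upwards [eventually_gt_atTop 0] with T hT using (le_abs_self _).trans (hpt T hT)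
    · refine isCoboundedUnder_le_of_eventually_le atTop (x := -g (2 * C)) ?_
      filter_upwards [eventually_gt_atTop 0, hBK] with T hT hTK
      exact (neg_abs_le _).trans' (neg_le_neg ((hpt T hT).trans (hg_mono hTK)))
    · exact isBoundedUnder_of_eventually_le (a := g (2 * C)) (hBK.mono fun T hTK => hg_mono hTK)
  have h2 : limsup (g ∘ timeMean E) atTop = g (limsup (timeMean E) atTop) :=
    (hg_mono.map_limsup_of_continuousAt (timeMean E) hg_cont.continuousAt hBbdd hBcobdd).symm
  rw [h2] at h1
  exact h1

/-- **Uniform energy bound from injection control.** If a global Leray–Hopf solution under a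
steady smooth force `f` (`ν ≥ 0`, sup-bounded energy) satisfies
`meanEnergy u ≤ C (1 + W)` with `W = limsup`-mean injection, then
`meanEnergy u ≤ 2 C⁺ + (C⁺ ‖f‖₂)²`, `C⁺ = max C 0`: the mean injection is non-negative
(`0 ≤ Λ⟨(f,u)⟩ ≤ W` for any generalized limit `Λ`), so `C` may be replaced by `C⁺`, and
`W ≤ ‖f‖₂ √(meanEnergy u)` turns the hypothesis into the quadratic inequality
`E ≤ C⁺ (1 + ‖f‖₂ √E)` (Doering–Foias 2002, §2). [folklore] -/
theorem dopplerClock_meanEnergy_le_of_le_mul (Λ : GeneralizedLimit) (hν : 0 ≤ ν)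
    (hf : IsSmooth f) (hu : IsGlobalLerayHopf ν (fun _ => f) u₀ u)
    (hsup : ∃ C : ℝ, ∀ t : ℝ, 0 ≤ t → kineticEnergy (u t) ≤ C) {Cc : ℝ}
    (hE : meanEnergy u ≤ Cc * (1 + longTimeAvgSup (fun t => ∫ x, ⟪f x, u t x⟫))) :
    meanEnergy u ≤ 2 * max Cc 0 + (max Cc 0 * Real.sqrt (∫ x, ‖f x‖ ^ 2)) ^ 2 := by
  obtain ⟨C, hC⟩ := hsup
  have hW0 : 0 ≤ longTimeAvgSup (fun t => ∫ x, ⟪f x, u t x⟫) :=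
    (impulseGrid_longTimeAvg_injection_nonneg Λ hν hf.continuous hu ⟨C, hC⟩).trans
      (LoudWakes.longTimeAvg_inner_le_longTimeAvgSup Λ hf.continuous hu ⟨C, hC⟩)
  have hE0 : 0 ≤ meanEnergy u := by
    rw [meanEnergy_eq_longTimeAvgSup]
    exact longTimeAvgSup_nonneg fun t => integral_nonneg fun _ => sq_nonneg _
  have hWle := dopplerClock_longTimeAvgSup_inner_le_sqrt hf hu hC
  have hA0 : 0 ≤ Real.sqrt (∫ x, ‖f x‖ ^ 2) := Real.sqrt_nonneg _
  have hCp0 : 0 ≤ max Cc 0 := le_max_right _ _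
  have hCle : Cc ≤ max Cc 0 := le_max_left _ _
  have h1 : meanEnergy u ≤ max Cc 0 * (1 + longTimeAvgSup (fun t => ∫ x, ⟪f x, u t x⟫)) :=
    hE.trans (mul_le_mul_of_nonneg_right hCle (by linarith))
  have hs0 : 0 ≤ Real.sqrt (meanEnergy u) := Real.sqrt_nonneg _
  have hss : Real.sqrt (meanEnergy u) ^ 2 = meanEnergy u := Real.sq_sqrt hE0
  have h2 : meanEnergy u ≤
      max Cc 0 + max Cc 0 * Real.sqrt (∫ x, ‖f x‖ ^ 2) * Real.sqrt (meanEnergy u) := by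
    have h3 : max Cc 0 * longTimeAvgSup (fun t => ∫ x, ⟪f x, u t x⟫) ≤
        max Cc 0 * (Real.sqrt (∫ x, ‖f x‖ ^ 2) * Real.sqrt (meanEnergy u)) :=
      mul_le_mul_of_nonneg_left hWle hCp0
    nlinarith [h1, h3]
  nlinarith [h2, hss, hs0, mul_nonneg hCp0 hA0,
    sq_nonneg (max Cc 0 * Real.sqrt (∫ x, ‖f x‖ ^ 2) - Real.sqrt (meanEnergy u))]

/-- **Two-sided uniform bound on the generalized mean of a pairing.** Along a global Leray–Hopf
solution with `sup_{t ≥ 0} ½‖u(t)‖₂² ≤ C` and `meanEnergy u ≤ E`, for a continuous field `a`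
with `‖a‖ ≤ K` and any generalized limit `Λ`: `|Λ⟨(a, u)⟩| ≤ K · ½ (1 + (E + 1))`, a bound
independent of `C` (`impulseGrid_longTimeAvg_inner_le` applied to `a` and to `-a`, linearity of
`Λ`; Doering–Foias 2002, §2). [folklore] -/
theorem dopplerClock_abs_longTimeAvg_inner_le (Λ : GeneralizedLimit)
    (hu : IsGlobalLerayHopf ν (fun _ => f) u₀ u) (ha : Continuous a) {K : ℝ} (hK0 : 0 ≤ K)
    (hK : ∀ x, ‖a x‖ ≤ K) {C : ℝ} (hC : ∀ t : ℝ, 0 ≤ t → kineticEnergy (u t) ≤ C) {E : ℝ}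
    (hE : meanEnergy u ≤ E) :
    |Λ.longTimeAvg (fun t => ∫ x, ⟪a x, u t x⟫)| ≤ K * (2⁻¹ * (1 + (E + 1))) := by
  have hcomm : ∀ b : UnitAddTorus (Fin 3) → EuclideanSpace ℝ (Fin 3),
      (fun t => ∫ x, ⟪b x, u t x⟫) = fun t => ∫ x, ⟪u t x, b x⟫ := fun b => by
    funext t
    exact integral_congr_ae (ae_of_all _ fun x => real_inner_comm _ _)
  have hup : Λ.longTimeAvg (fun t => ∫ x, ⟪a x, u t x⟫) ≤ K * (2⁻¹ * (1 + (E + 1))) := by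
    rw [hcomm a]
    exact impulseGrid_longTimeAvg_inner_le Λ hu ha hK0 hK hC hE
  have hKn : ∀ x, ‖(-a) x‖ ≤ K := fun x => by
    rw [Pi.neg_apply, norm_neg]
    exact hK x
  have hlo : Λ.longTimeAvg (fun t => ∫ x, ⟪(-a) x, u t x⟫) ≤ K * (2⁻¹ * (1 + (E + 1))) := by
    rw [hcomm (-a)]
    exact impulseGrid_longTimeAvg_inner_le Λ hu ha.neg hK0 hKn hC hE
  have hneg : Λ.longTimeAvg (fun t => ∫ x, ⟪(-a) x, u t x⟫) =
      -Λ.longTimeAvg (fun t => ∫ x, ⟪a x, u t x⟫) := by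
    have h1 : timeMean (fun t => ∫ x, ⟪(-a) x, u t x⟫) =
        -timeMean (fun t => ∫ x, ⟪a x, u t x⟫) := by
      funext T
      simp only [timeMean, Pi.neg_apply, inner_neg_left, integral_neg,
        intervalIntegral.integral_neg, mul_neg]
    unfold GeneralizedLimit.longTimeAvg
    rw [h1, map_neg]
  rw [hneg] at hlo
  exact abs_le.2 ⟨by linarith, hup⟩

/-- **Tail arithmetic of the glue.** If `P = c (ν κ B − T)` with `c > 0`, `ε₀ ≤ −T`, `|B| ≤ M`,
`ν, κ ≥ 0` and `ν (κ M + 1) < ε₀/2`, then `c · ε₀/2 ≤ P`. [folklore] -/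
theorem dopplerClock_tail_arith {c ν' κ M ε₀ B T P : ℝ} (hc : 0 < c)
    (hid : P = c * (ν' * κ * B - T)) (hfl : ε₀ ≤ -T) (hB : |B| ≤ M) (hν : 0 ≤ ν') (hκ : 0 ≤ κ)
    (hsmall : ν' * (κ * M + 1) < ε₀ / 2) : c * (ε₀ / 2) ≤ P := by
  rw [hid]
  refine mul_le_mul_of_nonneg_left ?_ hc.le
  have h1 : -M ≤ B := (abs_le.1 hB).1
  have h2 : ν' * κ * (-M) ≤ ν' * κ * B := mul_le_mul_of_nonneg_left h1 (mul_nonneg hν hκ)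
  nlinarith [h2, hsmall, hfl, hν]

/-- **The glue `CruxesGiveTarget` of route DopplerClock** (closes item
stmt-AnomalousDissipation-18135):
`QuadratureStressFloor → InjectionControlsEnergy → DopplerWorkIdentity → DopplerZerothLaw`.
Take the design and the family from C1; C2 with the non-negativity of the mean injection and
`W_j ≤ ‖f‖₂ √E_j` bounds the mean energies uniformly (`dopplerClock_meanEnergy_le_of_le_mul`);
the quadrature pairing `Λ⟨(Ψ_s, u_j)⟩` is then bounded uniformly
(`dopplerClock_abs_longTimeAvg_inner_le`), so the two-mode identity and the stress floor give
`Λ⟨(f, u_j)⟩ ≥ (F/(V·2πn)) · ε₀/2` for `j ≥ J` (`ν_j → 0`), whence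
`Λ ≤ limsup ≤ meanDissipation` by no leakage, and the target holds along the tail `j ↦ j + J`
(Doering–Foias 2002, §2; Foias–Manley–Rosa–Temam 2001, Ch. IV §1). [folklore] -/
theorem dopplerClockCruxesGiveTarget_proof :
    Summit.AnomalousDissipation.AnomalousDissipation.Theses.DopplerClock.CruxesGiveTarget := by
  unfold Summit.AnomalousDissipation.AnomalousDissipation.Theses.DopplerClock.CruxesGiveTarget
  intro h₁ h₂ hI
  obtain ⟨F, V, m, n, hF, hV, hm, hn, Λ, ν, u₀, u, hν, hν0, hLH, hmom, hsup, hnoleak, ε₀, hε₀,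
    hfloor⟩ := h₁
  obtain ⟨Cc, hCc⟩ := h₂ F V m n hF hV hm hn
  have hn' : (0 : ℝ) < (n : ℝ) := Nat.cast_pos.2 hn
  -- the force and the quadrature pattern are smooth
  have hfS : IsSmooth (fun (x : UnitAddTorus (Fin 3)) =>
      (F * (UnitAddTorus.mFourier (Pi.single (1 : Fin 3) (m : ℤ)) x).im *
        (UnitAddTorus.mFourier (Pi.single (2 : Fin 3) (n : ℤ)) x).re) •
        EuclideanSpace.single (0 : Fin 3) (1 : ℝ)) :=
    dopplerClock_isSmooth_im_mul_re_smul F _ _ _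
  have hΨS : IsSmooth (fun (y : UnitAddTorus (Fin 3)) =>
      ((UnitAddTorus.mFourier (Pi.single (1 : Fin 3) (m : ℤ)) y).im *
        (UnitAddTorus.mFourier (Pi.single (2 : Fin 3) (n : ℤ)) y).im) •
        EuclideanSpace.single (0 : Fin 3) (1 : ℝ)) :=
    dopplerClock_isSmooth_im_mul_im_smul _ _ _
  -- uniform mean-energy bound from C2
  obtain ⟨E, hE⟩ : ∃ E : ℝ, ∀ j, meanEnergy (u j) ≤ E :=
    ⟨_, fun j => dopplerClock_meanEnergy_le_of_le_mul Λ (hν j).le hfS (hLH j) (hsup j)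
      (hCc (ν j) (u₀ j) (u j) (hν j) (hLH j) (hmom j))⟩
  -- uniform bound on the quadrature pairing `Λ⟨(Ψ_s, u_j)⟩`
  obtain ⟨K, hK0, hK⟩ := exists_nonneg_forall_norm_le_of_continuous hΨS.continuous
  have hB : ∀ j, |Λ.longTimeAvg (fun t => ∫ x, ⟪((UnitAddTorus.mFourier
      (Pi.single (1 : Fin 3) (m : ℤ)) x).im * (UnitAddTorus.mFourier
      (Pi.single (2 : Fin 3) (n : ℤ)) x).im) • EuclideanSpace.single (0 : Fin 3) (1 : ℝ),
      u j t x⟫)| ≤ K * (2⁻¹ * (1 + (E + 1))) := by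
    intro j
    obtain ⟨C, hC⟩ := hsup j
    exact dopplerClock_abs_longTimeAvg_inner_le Λ (hLH j) hΨS.continuous hK0 hK hC (hE j)
  have hM0 : 0 ≤ K * (2⁻¹ * (1 + (E + 1))) := (abs_nonneg _).trans (hB 0)
  have hκ : (0 : ℝ) ≤ (2 * Real.pi) ^ 2 * ((m : ℝ) ^ 2 + (n : ℝ) ^ 2) := by positivity
  -- choose the tail: `ν_j (κ² M + 1) < ε₀ / 2` for `j ≥ J`
  have hden : 0 < 2 * ((2 * Real.pi) ^ 2 * ((m : ℝ) ^ 2 + (n : ℝ) ^ 2) *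
      (K * (2⁻¹ * (1 + (E + 1)))) + 1) := by positivity
  obtain ⟨J, hJ⟩ : ∃ J : ℕ, ∀ j ≥ J, ν j < ε₀ / (2 * ((2 * Real.pi) ^ 2 *
      ((m : ℝ) ^ 2 + (n : ℝ) ^ 2) * (K * (2⁻¹ * (1 + (E + 1)))) + 1)) :=
    eventually_atTop.1 (hν0.eventually (gt_mem_nhds (div_pos hε₀ hden)))
  have hc : 0 < F / (V * (2 * Real.pi * n)) := by positivity
  -- the dissipation floor along the tail
  have hfloorTail : ∀ j, J ≤ j →
      F / (V * (2 * Real.pi * n)) * (ε₀ / 2) ≤ meanDissipation (ν j) (u j) := by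
    intro j hj
    obtain ⟨C, hC⟩ := hsup j
    have hid := hI Λ F V (ν j) m n (u₀ j) (u j) hV (hν j) hn (hLH j) (hmom j) ⟨C, hC⟩
    have hsmall : ν j * ((2 * Real.pi) ^ 2 * ((m : ℝ) ^ 2 + (n : ℝ) ^ 2) *
        (K * (2⁻¹ * (1 + (E + 1)))) + 1) < ε₀ / 2 := by
      have h := (lt_div_iff₀ hden).1 (hJ j hj)
      linarith
    have hP := dopplerClock_tail_arith hc hid (hfloor j) (hB j) (hν j).le hκ hsmall
    exact hP.trans ((LoudWakes.longTimeAvg_inner_le_longTimeAvgSup Λ hfS.continuous (hLH j)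
      ⟨C, hC⟩).trans (hnoleak j))
  -- the target along the reindexed tail `j ↦ j + J`
  exact ⟨F, V, m, n, hF, hV, hm, hn, fun j => ν (j + J), fun j => u₀ (j + J),
    fun j => u (j + J), fun j => hν _, hν0.comp (tendsto_add_atTop_nat J), fun j => hLH _,
    fun j => hmom _, ⟨E, fun j => hE _⟩, F / (V * (2 * Real.pi * n)) * (ε₀ / 2), by positivity,
    fun j => hfloorTail (j + J) (Nat.le_add_left J j)⟩

end Summit.AnomalousDissipation.AnomalousDissipation.Theorems

end
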